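/-!
Scratch (refuter drefute g2): exhaustive arithmetic check of the WITNESS RECIPE for STUB 2b
`stub_mirrorDominationAxis0` (line sup-axis-reflection-transfer, crux stmt-QuantumFields-9442).

Conventions (derived in NOTES.md §2b from `configShift_apply`, link reflection `R_p` about the
time-link plane `p + 1/2`, `torusLift` periodicity `L = 2S+1`, torus translation invariance):
* `A` has time extent `[a₁, a₂]` (upper end counts `+1` for temporal tips), `τ_x B` has `[b₁+n, b₂+n]`,
  `n = x 0 = ‖x‖∞`, `S ≥ n` (since `x ∈ box 4 S`).
* plane `p`; placement: `a₂ ≤ p`, `p - S ≤ a₁`, `p + 1 ≤ b₁ + n`, `b₂ + n ≤ p + S + 1`.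
* mirror lags: `m₁ = 2p` (pair `(A, A^R)`), `m₂ = 2n - 2p` (pair `(B^R, B)`); a lag `m` is realised on
  the torus as `dist_L(m) = min(m mod L, L - m mod L) ∈ [0, S]` (periodicity + pair swap).
* window test: `|dist_L(mᵢ) - n| ≤ w`.
-/

def emod' (m L : Int) : Int := m % L   -- Lean 4 core `%` on Int = Euclidean remainder (nonneg for L > 0)

def distL (m S : Int) : Int :=
  let L := 2*S+1
  let r := emod' m L
  if r ≤ S then r else L - r

/-- placement feasibility + window membership for one instance, plane `p`, window `w`. -/
def inst_ok (a1 a2 b1 b2 n S p w : Int) : Bool :=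
  (a2 ≤ p) && (p - S ≤ a1) && (p + 1 ≤ b1 + n) && (b2 + n ≤ p + S + 1) &&
  ((distL (2*p) S - n).natAbs ≤ w.toNat) && ((distL (2*n - 2*p) S - n).natAbs ≤ w.toNat) &&
  (0 ≤ distL (2*p) S) && (distL (2*p) S ≤ S) && (0 ≤ distL (2*n-2*p) S) && (distL (2*n-2*p) S ≤ S)

/-- the recipe under test: p = ⌊(n + a₂ + b₁)/2⌋, w = W a b, n₀ = N0 a b. -/
def recipe_ok (W N0 : Int → Int → Int → Int → Int) (R Smax : Nat) : Bool :=
  (List.range (2*R+1)).all fun i1 => (List.range (2*R+1)).all fun i2 =>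
  (List.range (2*R+1)).all fun i3 => (List.range (2*R+1)).all fun i4 =>
    let a1 : Int := i1 - R; let a2 : Int := i2 - R; let b1 : Int := i3 - R; let b2 : Int := i4 - R
    if a1 ≤ a2 ∧ b1 ≤ b2 then
      (List.range (Smax+1)).all fun Sn => (List.range (Smax+1)).all fun nn =>
        let S : Int := Sn; let n : Int := nn
        if N0 a1 a2 b1 b2 ≤ n ∧ n ≤ S then
          inst_ok a1 a2 b1 b2 n S ((n + a2 + b1) / 2) (W a1 a2 b1 b2)
        else true
    else true

/-- first failing instance (for diagnostics). -/
def recipe_firstFail (W N0 : Int → Int → Int → Int → Int) (R Smax : Nat) : Option (Int × Int × Int × Int × Int × Int) :=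
  Id.run do
    for i1 in List.range (2*R+1) do
      for i2 in List.range (2*R+1) do
        for i3 in List.range (2*R+1) do
          for i4 in List.range (2*R+1) do
            let a1 : Int := i1 - R; let a2 : Int := i2 - R; let b1 : Int := i3 - R; let b2 : Int := i4 - R
            if a1 ≤ a2 ∧ b1 ≤ b2 then
              for Sn in List.range (Smax+1) do
                for nn in List.range (Smax+1) do
                  let S : Int := Sn; let n : Int := nn
                  if N0 a1 a2 b1 b2 ≤ n ∧ n ≤ S then
                    if !(inst_ok a1 a2 b1 b2 n S ((n + a2 + b1) / 2) (W a1 a2 b1 b2)) then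
                      return some (a1, a2, b1, b2, n, S)
    return none

-- Recipe L (lead's skeleton docstring): w = |a₂ + b₁| + 2, n₀ = |a₂+b₁| + 2 + |a₁|+|a₂|+|b₁|+|b₂|
def W_lead (_a1 a2 b1 _b2 : Int) : Int := (a2 + b1).natAbs + 2
def N0_big (a1 a2 b1 b2 : Int) : Int := (a2 + b1).natAbs + 2 + a1.natAbs + a2.natAbs + b1.natAbs + b2.natAbs
-- Recipe G (gen-1 survey): w = 2(|a₂+b₁|+2)+2, n₀ = 1 + |a₁|+|a₂|+|b₁|+|b₂| + (a₂-b₁)⁺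
def W_gen1 (_a1 a2 b1 _b2 : Int) : Int := 2 * ((a2 + b1).natAbs + 2) + 2
def N0_gen1 (a1 a2 b1 b2 : Int) : Int := 1 + a1.natAbs + a2.natAbs + b1.natAbs + b2.natAbs + max (a2 - b1) 0
-- Tight candidates: w = |a₂+b₁| + 1 ; n₀ = max (a₂ - b₁ + 2) (2*b₂ - a₂ - b₁ - 2) ⊔ (a₂ + b₁ - 2*a₁) ⊔ 1
def W_tight (_a1 a2 b1 _b2 : Int) : Int := (a2 + b1).natAbs + 1
def N0_tight (a1 a2 b1 b2 : Int) : Int := max (max (a2 - b1 + 2) (2*b2 - a2 - b1 - 2)) (max (a2 + b1 - 2*a1) 1)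
def W_tooTight (_a1 a2 b1 _b2 : Int) : Int := (a2 + b1).natAbs


#guard recipe_ok W_lead N0_big 3 14
-- gen-1 recipe (N0_gen1 with unclamped p) FAILS at (a₁,a₂,b₁,b₂,n,S) = (-3,0,0,0,4,4) (recipe_firstFail, evaluated in the seat folder copy):
#guard !(recipe_ok W_gen1 N0_gen1 3 14)
#guard !(recipe_ok W_tooTight N0_big 3 14)
#guard recipe_ok W_tight N0_tight 4 24
#guard recipe_ok W_lead N0_tight 4 24
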